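import Mathlib
import Literature.Analysis.FluidPDE.Tao2016AveragedNS.LocalCascadeSolutions
import Literature.Analysis.FluidPDE.Tao2016AveragedNS.RestartedCascadeFlows
import Literature.Analysis.FluidPDE.Tao2016AveragedNS.ShiftSetCascadeFlows
import Summits.NavierStokesRegularity.NavierStokesRegularity.Theorems.TaoLadderRungTwoFlatSplitLayerDefs
import HarnessLib

/-!
# The FORWARD r-CLOSURE reference set: a `Z`-free, `ρ`-free form of format-v2 gap data (`GapData₂On`)
  (helper for item stmt-NavierStokesRegularity-22987 `FlatGapCertificatesV2`, crux K_A♭ of route TaoLadderRungTwoFlat;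
  cell harvest/h2-tao-ladder — theory-1 g35's cell file numT47/ReachClosure47.lean (sha16 f5d6d59941356caf), format part,
  landed by p1 g20 with the namespace re-homed to `…Theorems.ReachClosure` and the SPLIT-T47-specific child statements
  dropped (superseded by SPLIT-T48); lemma L7 «assembly» of the analytic lane, LADDER §47.5; p1 g21: the unused import of the
  ROUTE file replaced by the Literature format modules — lint.theses-cone, referee W-16′ — declarations unchanged)

For a table `α` on a shift set `𝕊`, scale ratio `1+ε₀`, datum `X₀` (observable `i₀`), weights `w`, radius `r`,
ratio exponent `θ₀`, clock window `c₀` and energy envelope `env₀`, the set `reachSet …` of states REACHABLE from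
the normalised datum by legal hops — start within weighted distance `r` of a reachable state, run an exact flow
for at least `c₀`, re-centre at a time `0 < τ₁ ≤ c₀` with a ratio `(1+ε₀)^{-θ₀} ≤ a ≤ |S i₀ 1 τ₁|` and energies
under the envelope on `[0, τ₁]` — is the least reference set closed under the format's own step. If the format-v2
clauses hold with `Z := reachSet …` and with the step clause asked only in its CORE form (no ball condition on the
re-centred state), then `GapData₂On 𝕊 σ ε₀ i₀ α X₀ (reachSet …) w r 0 θ₀ θ c₀ c env₀` — the ρ-ball clause holds BY
CONSTRUCTION with `ρ = 0` (the re-centred state is itself reachable): `robustHoppingOn_gapData₂On`. So a prover of a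
transfer theorem never has to describe `Z` or prove a contraction INTO a described set: the content is «every state
within `r` of a reachable state hops, with floor, slack, tails and envelope» (`RobustHoppingOn`).

HONEST FRAMING: MODEL lattice vocabulary (Tao 2016 §4/§6, cell certificate format v2); definitions and a packaging
lemma; nothing certified; nothing about the Navier–Stokes equations.
-/

noncomputable section

-- the sub-problem namespace repeats the summit name by design (D-0017)
set_option linter.dupNamespace false

namespace Summit.NavierStokesRegularity.NavierStokesRegularity.Theorems.ReachClosure

open Set Literature.Analysis.FluidPDE Literature.Analysis.FluidPDE.TaoCascade

variable {m : ℕ}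

/-- The CORE of one checkpoint step (the format's `StepTo` with a trivial transition-state description):
clock, positivity, ratio floor, amplitude bound, energies under the envelope on `[0, τ₁]`. [cite: Tao2016AveragedNS, §6.4 Prop. 6.5 (statement shape of the checkpoint step); cell certificate format v2, route TaoLadderRungTwoFlat] -/
def StepCore (ε₀ θ₀ c₀ : ℝ) (i₀ : Fin m) (env₀ : ℤ → ℝ) (S F : Fin m → ℤ → ℝ → ℝ) (τ₁ a : ℝ) : Prop :=
  StepTo ε₀ θ₀ c₀ i₀ (fun _ _ => True) (epochEnvelope env₀) S F τ₁ a

/-- **REACHABLE STATES** (the forward `r`-closure of the normalised datum under legal hops). [cite: Tao2016AveragedNS, §6.4 Prop. 6.5 (statement shape of the checkpoint step); cell certificate format v2, route TaoLadderRungTwoFlat] -/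
inductive Reach (𝕊 : Finset (ℤ × ℤ × ℤ)) (ε₀ : ℝ) (i₀ : Fin m) (α : Fin m → Fin m → Fin m → ℤ × ℤ × ℤ → ℝ)
    (X₀ : Fin m → ℝ) (w : ℤ → ℝ) (r θ₀ c₀ : ℝ) (env₀ : ℤ → ℝ) : (Fin m → ℤ → ℝ) → Prop
  | datum : Reach 𝕊 ε₀ i₀ α X₀ w r θ₀ c₀ env₀ (datumState i₀ X₀)
  | hop {z S₀ : Fin m → ℤ → ℝ} {τ : ℝ} {S F : Fin m → ℤ → ℝ → ℝ} {τ₁ a : ℝ} :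
      Reach 𝕊 ε₀ i₀ α X₀ w r θ₀ c₀ env₀ z →
      (∀ i k, w k * |S₀ i k - z i k| ≤ r) → c₀ ≤ τ →
      PseudoFlowOnShift 𝕊 τ ε₀ α 0 0 S₀ (fun i k => (1 / 2) * S₀ i k ^ 2) (fun _ _ => 0) S F →
      StepCore ε₀ θ₀ c₀ i₀ env₀ S F τ₁ a →
      Reach 𝕊 ε₀ i₀ α X₀ w r θ₀ c₀ env₀ (fun i k => S i (1 + k) τ₁ / a)

/-- The reachable states as a set. [cite: Tao2016AveragedNS, §6.4 Prop. 6.5 (statement shape of the checkpoint step); cell certificate format v2, route TaoLadderRungTwoFlat] -/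
def reachSet (𝕊 : Finset (ℤ × ℤ × ℤ)) (ε₀ : ℝ) (i₀ : Fin m) (α : Fin m → Fin m → Fin m → ℤ × ℤ × ℤ → ℝ)
    (X₀ : Fin m → ℝ) (w : ℤ → ℝ) (r θ₀ c₀ : ℝ) (env₀ : ℤ → ℝ) : Set (Fin m → ℤ → ℝ) :=
  {z | Reach 𝕊 ε₀ i₀ α X₀ w r θ₀ c₀ env₀ z}

/-- **ROBUST HOPPING** = the format-v2 clauses with the reference set fixed to the reachable states and the step
asked only in core form (no ball condition on the re-centred state, no ρ). [cite: Tao2016AveragedNS, §6.4 Prop. 6.5 (statement shape of the checkpoint step); cell certificate format v2, route TaoLadderRungTwoFlat] -/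
def RobustHoppingOn (𝕊 : Finset (ℤ × ℤ × ℤ)) (σ ε₀ : ℝ) (i₀ : Fin m)
    (α : Fin m → Fin m → Fin m → ℤ × ℤ × ℤ → ℝ) (X₀ : Fin m → ℝ) (w : ℤ → ℝ) (r θ₀ θ c₀ c : ℝ)
    (env₀ : ℤ → ℝ) : Prop :=
  0 < r ∧ 0 ≤ θ₀ ∧ θ₀ < θ ∧ θ ≤ 1 / 2 ∧ 0 < c₀ ∧ c₀ < c ∧ 0 < σ ∧ (∀ k, 1 ≤ w k) ∧
    TailFat ε₀ (reachSet 𝕊 ε₀ i₀ α X₀ w r θ₀ c₀ env₀) w r ∧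
    TameBehind ε₀ (reachSet 𝕊 ε₀ i₀ α X₀ w r θ₀ c₀ env₀) w ∧
    TailCompat ε₀ (reachSet 𝕊 ε₀ i₀ α X₀ w r θ₀ c₀ env₀) w r env₀ ∧
    (∀ S₀ : Fin m → ℤ → ℝ,
      ballDesc (reachSet 𝕊 ε₀ i₀ α X₀ w r θ₀ c₀ env₀) w r S₀ (fun i k => (1 / 2) * S₀ i k ^ 2) →
        ∃ S F : Fin m → ℤ → ℝ → ℝ,
          PseudoFlowOnShift 𝕊 c ε₀ α 0 0 S₀ (fun i k => (1 / 2) * S₀ i k ^ 2) (fun _ _ => 0) S F) ∧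
    ∀ (S₀ : Fin m → ℤ → ℝ) (τ : ℝ) (S F : Fin m → ℤ → ℝ → ℝ),
      ballDesc (reachSet 𝕊 ε₀ i₀ α X₀ w r θ₀ c₀ env₀) w r S₀ (fun i k => (1 / 2) * S₀ i k ^ 2) →
        c₀ ≤ τ →
          PseudoFlowOnShift 𝕊 τ ε₀ α 0 0 S₀ (fun i k => (1 / 2) * S₀ i k ^ 2) (fun _ _ => 0) S F →
            ∃ τ₁ a : ℝ, StepCore ε₀ θ₀ c₀ i₀ env₀ S F τ₁ a ∧ (1 + σ) * a ≤ |S i₀ 1 τ₁|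

/-- From a core step out of the `r`-ball around a reachable state, the full `StepTo` with the ρ = 0 ball:
the re-centred state is reachable, hence in the ball of radius `0 · r` around the reachable set. [cite: Tao2016AveragedNS, §6.4 Prop. 6.5 (statement shape of the checkpoint step); cell certificate format v2, route TaoLadderRungTwoFlat] -/
theorem stepTo_reach {𝕊 : Finset (ℤ × ℤ × ℤ)} {ε₀ : ℝ} {i₀ : Fin m}
    {α : Fin m → Fin m → Fin m → ℤ × ℤ × ℤ → ℝ} {X₀ : Fin m → ℝ} {w : ℤ → ℝ} {r θ₀ c₀ : ℝ}
    {env₀ : ℤ → ℝ} {z S₀ : Fin m → ℤ → ℝ} {τ : ℝ} {S F : Fin m → ℤ → ℝ → ℝ} {τ₁ a : ℝ}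
    (hz : Reach 𝕊 ε₀ i₀ α X₀ w r θ₀ c₀ env₀ z) (hkick : ∀ i k, w k * |S₀ i k - z i k| ≤ r) (hτ : c₀ ≤ τ)
    (hflow : PseudoFlowOnShift 𝕊 τ ε₀ α 0 0 S₀ (fun i k => (1 / 2) * S₀ i k ^ 2) (fun _ _ => 0) S F)
    (hcore : StepCore ε₀ θ₀ c₀ i₀ env₀ S F τ₁ a) :
    StepTo ε₀ θ₀ c₀ i₀ (ballDesc (reachSet 𝕊 ε₀ i₀ α X₀ w r θ₀ c₀ env₀) w (0 * r)) (epochEnvelope env₀)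
      S F τ₁ a := by
  obtain ⟨h1, h2, h3, h4, h5, -, h7⟩ := hcore
  refine ⟨h1, h2, h3, h4, h5, ?_, h7⟩
  refine ⟨fun i k => S i (1 + k) τ₁ / a, Reach.hop hz hkick hτ hflow ⟨h1, h2, h3, h4, h5, trivial, h7⟩, ?_⟩
  intro i k
  simp

/-- **`RobustHoppingOn` ⇒ format-v2 gap data with `Z := reachSet`, `ρ := 0`.** [cite: Tao2016AveragedNS, §6.4 Prop. 6.5 (statement shape of the checkpoint step); cell certificate format v2, route TaoLadderRungTwoFlat] -/
theorem robustHoppingOn_gapData₂On {𝕊 : Finset (ℤ × ℤ × ℤ)} {σ ε₀ : ℝ} {i₀ : Fin m}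
    {α : Fin m → Fin m → Fin m → ℤ × ℤ × ℤ → ℝ} {X₀ : Fin m → ℝ} {w : ℤ → ℝ} {r θ₀ θ c₀ c : ℝ}
    {env₀ : ℤ → ℝ} (h : RobustHoppingOn 𝕊 σ ε₀ i₀ α X₀ w r θ₀ θ c₀ c env₀) :
    GapData₂On 𝕊 σ ε₀ i₀ α X₀ (reachSet 𝕊 ε₀ i₀ α X₀ w r θ₀ c₀ env₀) w r 0 θ₀ θ c₀ c env₀ := by
  obtain ⟨hr, hθ0, hθ, hθh, hc0, hc, hσ, hw, hfat, htame, hcompat, hexist, hstep⟩ := h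
  have hstep' : ∀ (S₀ : Fin m → ℤ → ℝ) (τ : ℝ) (S F : Fin m → ℤ → ℝ → ℝ),
      ballDesc (reachSet 𝕊 ε₀ i₀ α X₀ w r θ₀ c₀ env₀) w r S₀ (fun i k => (1 / 2) * S₀ i k ^ 2) →
        c₀ ≤ τ →
          PseudoFlowOnShift 𝕊 τ ε₀ α 0 0 S₀ (fun i k => (1 / 2) * S₀ i k ^ 2) (fun _ _ => 0) S F →
            ∃ τ₁ a : ℝ, StepTo ε₀ θ₀ c₀ i₀
              (ballDesc (reachSet 𝕊 ε₀ i₀ α X₀ w r θ₀ c₀ env₀) w (0 * r)) (epochEnvelope env₀) S F τ₁ a ∧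
              (1 + σ) * a ≤ |S i₀ 1 τ₁| := by
    intro S₀ τ S F hball hτ hflow
    obtain ⟨z, hz, hkick⟩ := hball
    obtain ⟨τ₁, a, hcore, hslack⟩ := hstep S₀ τ S F ⟨z, hz, hkick⟩ hτ hflow
    exact ⟨τ₁, a, stepTo_reach hz hkick hτ hflow hcore, hslack⟩
  refine ⟨⟨hr, le_rfl, zero_lt_one, hθ0, hθ, hθh, hc0, hc, hw, Reach.datum, hfat, hexist, ?_⟩, hσ, htame,
    hstep', hcompat⟩
  intro S₀ τ S F hball hτ hflow
  obtain ⟨τ₁, a, hst, -⟩ := hstep' S₀ τ S F hball hτ hflow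
  exact ⟨τ₁, a, hst⟩

end Summit.NavierStokesRegularity.NavierStokesRegularity.Theorems.ReachClosure

end
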